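import Mathlib.Analysis.Calculus.LineDeriv.IntegrationByParts
import Mathlib.Analysis.Calculus.Deriv.Inv
import Mathlib.Analysis.InnerProductSpace.Calculus
import Mathlib.Analysis.InnerProductSpace.PiL2
import Mathlib.Analysis.SpecialFunctions.Sqrt
import Mathlib.Analysis.SpecialFunctions.Pow.Real
import Mathlib.MeasureTheory.Integral.MeanInequalities
import Mathlib.MeasureTheory.Integral.Bochner.ContinuousLinearMap
import Mathlib.MeasureTheory.Function.L2Space
import HarnessLib

/-!
# The planar Hardy-type inequality `∫ φ²/|y − x₀| dy ≤ 2 ‖φ‖_{L²} ‖Dφ‖_{L²}`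

Analysis/FluidPDE file (all results proved, no definitions, no named facts). On `ℝ²` the weight
`|y − x₀|⁻¹` is the divergence of the unit radial field `(y − x₀)/|y − x₀|`, whence for
`φ ∈ C¹_c(ℝ²)`

  `∫ φ(y)²/|y − x₀| dy = −2 ∫ φ ∇φ·(y − x₀)/|y − x₀| dy ≤ 2 ‖φ‖_{L²} ‖Dφ‖_{L²}`.

We prove it (`integral_sq_div_norm_sub_le`) through the smooth regularisation
`m_ε(y) = (|y − x₀|² + ε²)^{-1/2}`: the field `F_ε = (y − x₀) m_ε` has `|F_ε| ≤ 1` and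
`div F_ε = 2m_ε − |y − x₀|² m_ε³ ≥ m_ε` (`inv_regNorm_le_div_regField`), so one integration by
parts per coordinate gives `∫ φ² m_ε ≤ 2 ‖φ‖_{L²} ‖Dφ‖_{L²}` (`integral_sq_mul_inv_regNorm_le`),
and `ε → 0` by monotone convergence. This is the estimate that makes the planar Biot–Savart
integral `∫ ω(y) (x − y)^⊥/(2π|x − y|²) dy` absolutely convergent, with an `L^∞` bound, for
vorticities with merely `ω, ∇ω ∈ L²` — the nonlinear input of the asymmetric Burgers vortex
problem (`Literature.Analysis.FluidPDE.GallayMaekawa2016_thm41`) — without an `Lᵖ`, `p > 2`,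
Sobolev embedding.

## References

* Folklore (the identity `div (y/|y|) = 1/|y|` in the plane). [folklore]
-/

open MeasureTheory Filter Set Metric
open scoped Real RealInnerProductSpace Topology InnerProductSpace ENNReal

noncomputable section

namespace Literature.Analysis.FluidPDE

/-! ### The regularised inverse distance `m_ε(y) = (|y − x₀|² + ε²)^{-1/2}` -/

section RegNorm

variable (x₀ : EuclideanSpace ℝ (Fin 2)) {ε : ℝ} (hε : 0 < ε)
include hε

/-- `n_ε = (|y−x₀|² + ε²)^{1/2} > 0`. [folklore] -/
theorem regNorm_pos (y : EuclideanSpace ℝ (Fin 2)) : 0 < Real.sqrt (‖y - x₀‖ ^ 2 + ε ^ 2) :=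
  Real.sqrt_pos.2 (by positivity)

/-- `n_ε² = |y − x₀|² + ε²`. [folklore] -/
theorem regNorm_sq (y : EuclideanSpace ℝ (Fin 2)) :
    Real.sqrt (‖y - x₀‖ ^ 2 + ε ^ 2) ^ 2 = ‖y - x₀‖ ^ 2 + ε ^ 2 :=
  Real.sq_sqrt (by positivity)

/-- `|y − x₀| ≤ n_ε(y)`. [folklore] -/
theorem norm_sub_le_regNorm (y : EuclideanSpace ℝ (Fin 2)) :
    ‖y - x₀‖ ≤ Real.sqrt (‖y - x₀‖ ^ 2 + ε ^ 2) := by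
  rw [Real.le_sqrt (norm_nonneg _) (by positivity)]
  nlinarith

/-- `|y − x₀| m_ε(y) ≤ 1`. [folklore] -/
theorem norm_sub_mul_inv_regNorm_le_one (y : EuclideanSpace ℝ (Fin 2)) :
    ‖y - x₀‖ * (Real.sqrt (‖y - x₀‖ ^ 2 + ε ^ 2))⁻¹ ≤ 1 := by
  rw [mul_inv_le_iff₀ (regNorm_pos x₀ hε y), one_mul]
  exact norm_sub_le_regNorm x₀ hε y

/-- **`div F_ε ≥ m_ε`**, pointwise: `|y − x₀|² m_ε³ ≤ m_ε`, i.e.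
`m_ε ≤ 2 m_ε − |y − x₀|² m_ε³ = ∑ᵢ ∂ᵢ((yᵢ − x₀ᵢ) m_ε)`. [folklore] -/
theorem inv_regNorm_le_div_regField (y : EuclideanSpace ℝ (Fin 2)) :
    (Real.sqrt (‖y - x₀‖ ^ 2 + ε ^ 2))⁻¹ ≤
      2 * (Real.sqrt (‖y - x₀‖ ^ 2 + ε ^ 2))⁻¹ -
        ‖y - x₀‖ ^ 2 * (Real.sqrt (‖y - x₀‖ ^ 2 + ε ^ 2))⁻¹ ^ 3 := by
  have hn := regNorm_pos x₀ hε y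
  have hsq := regNorm_sq x₀ hε y
  set n := Real.sqrt (‖y - x₀‖ ^ 2 + ε ^ 2) with hn_def
  have hle : ‖y - x₀‖ ^ 2 * n⁻¹ ^ 3 ≤ n⁻¹ := by
    rw [show n⁻¹ ^ 3 = n⁻¹ * (n ^ 2)⁻¹ by field_simp, ← mul_assoc, mul_comm (‖y - x₀‖ ^ 2),
      mul_assoc]
    refine mul_le_of_le_one_right (inv_nonneg.2 hn.le) ?_
    rw [mul_inv_le_iff₀ (by positivity), one_mul, hsq]
    nlinarith
  linarith

/-- The derivative of `m_ε`: `Dm_ε(y)[v] = −m_ε(y)³ ⟪y − x₀, v⟫`. [folklore] -/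
theorem hasFDerivAt_inv_regNorm (y : EuclideanSpace ℝ (Fin 2)) :
    HasFDerivAt (fun z : EuclideanSpace ℝ (Fin 2) => (Real.sqrt (‖z - x₀‖ ^ 2 + ε ^ 2))⁻¹)
      ((-(Real.sqrt (‖y - x₀‖ ^ 2 + ε ^ 2))⁻¹ ^ 3) • innerSL ℝ (y - x₀)) y := by
  have hn := regNorm_pos x₀ hε y
  -- `s(z) = |z − x₀|² + ε²`
  have hs : HasFDerivAt (fun z : EuclideanSpace ℝ (Fin 2) => ‖z - x₀‖ ^ 2 + ε ^ 2)
      ((2 : ℝ) • innerSL ℝ (y - x₀)) y := by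
    have h0 := (((hasStrictFDerivAt_norm_sq (y - x₀)).hasFDerivAt).comp y
      ((hasFDerivAt_id y).sub_const x₀)).add_const (ε ^ 2)
    refine h0.congr_fderiv ?_
    ext v
    simp [two_smul]
  -- `g(t) = (√t)⁻¹`
  have ht0 : ‖y - x₀‖ ^ 2 + ε ^ 2 ≠ 0 := by positivity
  have hg : HasDerivAt (fun t : ℝ => (Real.sqrt t)⁻¹)
      (-(1 / (2 * Real.sqrt (‖y - x₀‖ ^ 2 + ε ^ 2))) / Real.sqrt (‖y - x₀‖ ^ 2 + ε ^ 2) ^ 2)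
      (‖y - x₀‖ ^ 2 + ε ^ 2) :=
    (Real.hasDerivAt_sqrt ht0).fun_inv hn.ne'
  have h := hg.comp_hasFDerivAt y hs
  refine h.congr_fderiv ?_
  ext v
  simp only [FunLike.coe_smul, Pi.smul_apply, smul_eq_mul, innerSL_apply_apply]
  field_simp

/-- `m_ε` is `C¹`. [folklore] -/
theorem contDiff_inv_regNorm :
    ContDiff ℝ 1 fun z : EuclideanSpace ℝ (Fin 2) => (Real.sqrt (‖z - x₀‖ ^ 2 + ε ^ 2))⁻¹ :=
  ((((contDiff_norm_sq ℝ).comp (contDiff_id.sub contDiff_const)).add contDiff_const).sqrt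
    fun z => ne_of_gt (by positivity : (0 : ℝ) < ‖z - x₀‖ ^ 2 + ε ^ 2)).inv
    fun z => (regNorm_pos x₀ hε z).ne'

/-- `m_ε` is continuous. [folklore] -/
theorem continuous_inv_regNorm :
    Continuous fun z : EuclideanSpace ℝ (Fin 2) => (Real.sqrt (‖z - x₀‖ ^ 2 + ε ^ 2))⁻¹ :=
  (contDiff_inv_regNorm x₀ hε).continuous

/-- The components `Fᵢ = (yᵢ − x₀ᵢ) m_ε` of the regularised radial field and their derivative.
[folklore] -/
theorem hasFDerivAt_regField (i : Fin 2) (y : EuclideanSpace ℝ (Fin 2)) :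
    HasFDerivAt (fun z : EuclideanSpace ℝ (Fin 2) => (z i - x₀ i) * (Real.sqrt (‖z - x₀‖ ^ 2 + ε ^ 2))⁻¹)
      ((y i - x₀ i) • ((-(Real.sqrt (‖y - x₀‖ ^ 2 + ε ^ 2))⁻¹ ^ 3) • innerSL ℝ (y - x₀)) +
        (Real.sqrt (‖y - x₀‖ ^ 2 + ε ^ 2))⁻¹ •
          (EuclideanSpace.proj i : EuclideanSpace ℝ (Fin 2) →L[ℝ] ℝ)) y := by
  have hcoord : HasFDerivAt (fun z : EuclideanSpace ℝ (Fin 2) => z i - x₀ i)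
      (EuclideanSpace.proj i : EuclideanSpace ℝ (Fin 2) →L[ℝ] ℝ) y :=
    ((EuclideanSpace.proj i : EuclideanSpace ℝ (Fin 2) →L[ℝ] ℝ).hasFDerivAt).sub_const _
  exact hcoord.mul (hasFDerivAt_inv_regNorm x₀ hε y)

/-- `∂ᵢFᵢ = m_ε − (yᵢ − x₀ᵢ)² m_ε³`. [folklore] -/
theorem fderiv_regField_apply_single (i : Fin 2) (y : EuclideanSpace ℝ (Fin 2)) :
    fderiv ℝ (fun z : EuclideanSpace ℝ (Fin 2) => (z i - x₀ i) * (Real.sqrt (‖z - x₀‖ ^ 2 + ε ^ 2))⁻¹) y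
        (EuclideanSpace.single i 1) =
      (Real.sqrt (‖y - x₀‖ ^ 2 + ε ^ 2))⁻¹ -
        (y i - x₀ i) ^ 2 * (Real.sqrt (‖y - x₀‖ ^ 2 + ε ^ 2))⁻¹ ^ 3 := by
  rw [(hasFDerivAt_regField x₀ hε i y).fderiv]
  simp only [add_apply, FunLike.coe_smul, Pi.smul_apply, innerSL_apply_apply, smul_eq_mul,
    EuclideanSpace.inner_single_right]
  simp
  ring

/-- `Fᵢ` is `C¹`. [folklore] -/
theorem contDiff_regField (i : Fin 2) :
    ContDiff ℝ 1 fun z : EuclideanSpace ℝ (Fin 2) => (z i - x₀ i) * (Real.sqrt (‖z - x₀‖ ^ 2 + ε ^ 2))⁻¹ :=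
  (((EuclideanSpace.proj i : EuclideanSpace ℝ (Fin 2) →L[ℝ] ℝ).contDiff.sub contDiff_const).mul
    (contDiff_inv_regNorm x₀ hε))

end RegNorm

/-! ### The regularised inequality `∫ φ² m_ε ≤ 2‖φ‖₂‖Dφ‖₂` -/

section Regularised

variable {φ : EuclideanSpace ℝ (Fin 2) → ℝ} (hφ : ContDiff ℝ 1 φ) (hφc : HasCompactSupport φ)
  (x₀ : EuclideanSpace ℝ (Fin 2)) {ε : ℝ} (hε : 0 < ε)
include hφ hφc hε

/-- One integration by parts against `Fᵢ = (yᵢ − x₀ᵢ) m_ε`: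
`∫ φ² ∂ᵢFᵢ = −∫ 2φ ∂ᵢφ Fᵢ`. [folklore] -/
theorem integral_sq_mul_fderiv_regField (i : Fin 2) :
    ∫ y : EuclideanSpace ℝ (Fin 2), φ y ^ 2 *
        ((Real.sqrt (‖y - x₀‖ ^ 2 + ε ^ 2))⁻¹ -
          (y i - x₀ i) ^ 2 * (Real.sqrt (‖y - x₀‖ ^ 2 + ε ^ 2))⁻¹ ^ 3) =
      -∫ y : EuclideanSpace ℝ (Fin 2), 2 * φ y * fderiv ℝ φ y (EuclideanSpace.single i 1) *
        ((y i - x₀ i) * (Real.sqrt (‖y - x₀‖ ^ 2 + ε ^ 2))⁻¹) := by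
  set F : EuclideanSpace ℝ (Fin 2) → ℝ := fun z =>
    (z i - x₀ i) * (Real.sqrt (‖z - x₀‖ ^ 2 + ε ^ 2))⁻¹ with hF_def
  have hFc : ContDiff ℝ 1 F := contDiff_regField x₀ hε i
  have hFcont : Continuous F := hFc.continuous
  have hF1c : Continuous fun y => fderiv ℝ F y (EuclideanSpace.single i 1) :=
    (hFc.continuous_fderiv one_ne_zero).clm_apply continuous_const
  have hφd : Differentiable ℝ φ := hφ.differentiable one_ne_zero
  have hφ1c : Continuous fun y => fderiv ℝ φ y (EuclideanSpace.single i 1) :=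
    (hφ.continuous_fderiv one_ne_zero).clm_apply continuous_const
  -- `f = φ²`
  have hfd : ∀ y, HasFDerivAt (fun z => φ z ^ 2) ((2 * φ y) • fderiv ℝ φ y) y := fun y => by
    have := ((hφd y).hasFDerivAt).pow 2
    simpa using this
  have hf' : ∀ y, fderiv ℝ (fun z => φ z ^ 2) y (EuclideanSpace.single i 1) =
      2 * φ y * fderiv ℝ φ y (EuclideanSpace.single i 1) := fun y => by
    rw [(hfd y).fderiv]; simp
  have hfs : HasCompactSupport fun z => φ z ^ 2 := hφc.mono (by
    intro x hx
    simp only [Function.mem_support, ne_eq] at hx ⊢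
    contrapose! hx
    simp [hx])
  have hf's : HasCompactSupport fun y => fderiv ℝ (fun z => φ z ^ 2) y (EuclideanSpace.single i 1) := by
    refine hφc.mono ?_
    intro x hx
    simp only [Function.mem_support, ne_eq, hf'] at hx ⊢
    contrapose! hx
    simp [hx]
  -- the three products are continuous with compact support
  have i1 : Integrable fun y => fderiv ℝ (fun z => φ z ^ 2) y (EuclideanSpace.single i 1) * F y := by
    have hc : Continuous fun y => fderiv ℝ (fun z => φ z ^ 2) y (EuclideanSpace.single i 1) := by
      simp_rw [hf']; exact (continuous_const.mul hφ.continuous).mul hφ1c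
    exact (hc.mul hFcont).integrable_of_hasCompactSupport hf's.mul_right
  have i2 : Integrable fun y => φ y ^ 2 * fderiv ℝ F y (EuclideanSpace.single i 1) :=
    ((hφ.continuous.pow 2).mul hF1c).integrable_of_hasCompactSupport hfs.mul_right
  have i3 : Integrable fun y => φ y ^ 2 * F y :=
    ((hφ.continuous.pow 2).mul hFcont).integrable_of_hasCompactSupport hfs.mul_right
  have hibp := integral_mul_fderiv_eq_neg_fderiv_mul_of_integrable i1 i2 i3
    (fun y _ => (hfd y).differentiableAt) (fun y _ => (hFc.differentiable one_ne_zero) y)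
  -- `hibp : ∫ φ² ∂ᵢF = −∫ ∂ᵢ(φ²) F`
  calc ∫ y : EuclideanSpace ℝ (Fin 2), φ y ^ 2 *
        ((Real.sqrt (‖y - x₀‖ ^ 2 + ε ^ 2))⁻¹ -
          (y i - x₀ i) ^ 2 * (Real.sqrt (‖y - x₀‖ ^ 2 + ε ^ 2))⁻¹ ^ 3)
      = ∫ y, φ y ^ 2 * fderiv ℝ F y (EuclideanSpace.single i 1) := by
        refine integral_congr_ae (Eventually.of_forall fun y => ?_)
        dsimp only
        rw [hF_def, fderiv_regField_apply_single x₀ hε i y]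
    _ = -∫ y, fderiv ℝ (fun z => φ z ^ 2) y (EuclideanSpace.single i 1) * F y := hibp
    _ = _ := by
        congr 1
        refine integral_congr_ae (Eventually.of_forall fun y => ?_)
        dsimp only
        rw [hf']

/-- **The regularised Hardy inequality**: for `φ ∈ C¹_c(ℝ²)`, `ε > 0` and any centre `x₀`,
`∫ φ² m_ε ≤ 2 ‖φ‖_{L²} ‖Dφ‖_{L²}`, `m_ε = (|y − x₀|² + ε²)^{-1/2}`: from `m_ε ≤ div F_ε`,
integration by parts, `|F_ε| ≤ 1` and the Cauchy–Schwarz inequality. [folklore] -/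
theorem integral_sq_mul_inv_regNorm_le :
    ∫ y : EuclideanSpace ℝ (Fin 2), φ y ^ 2 * (Real.sqrt (‖y - x₀‖ ^ 2 + ε ^ 2))⁻¹ ≤
      2 * Real.sqrt (∫ y, φ y ^ 2) * Real.sqrt (∫ y, ‖fderiv ℝ φ y‖ ^ 2) := by
  set m : EuclideanSpace ℝ (Fin 2) → ℝ := fun y => (Real.sqrt (‖y - x₀‖ ^ 2 + ε ^ 2))⁻¹ with hm_def
  have hmpos : ∀ y, 0 < m y := fun y => inv_pos.2 (regNorm_pos x₀ hε y)
  have hmc : Continuous m := continuous_inv_regNorm x₀ hε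
  have hφ1c : ∀ j : Fin 2, Continuous fun y => fderiv ℝ φ y (EuclideanSpace.single j 1) := fun j =>
    (hφ.continuous_fderiv one_ne_zero).clm_apply continuous_const
  have hDc : Continuous fun y => ‖fderiv ℝ φ y‖ := (hφ.continuous_fderiv one_ne_zero).norm
  have hsupp : ∀ {G : EuclideanSpace ℝ (Fin 2) → ℝ}, (∀ x, φ x = 0 → G x = 0) → HasCompactSupport G :=
    fun hG => hφc.mono (by
      intro x hx
      simp only [Function.mem_support, ne_eq] at hx ⊢
      contrapose! hx
      exact hG x hx)
  -- Step 1: `∫ φ² m ≤ ∫ φ² div F`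
  have iL : Integrable fun y => φ y ^ 2 * m y :=
    ((hφ.continuous.pow 2).mul hmc).integrable_of_hasCompactSupport (hsupp fun x hx => by simp [hx])
  have idiv : ∀ j : Fin 2, Integrable fun y : EuclideanSpace ℝ (Fin 2) =>
      φ y ^ 2 * (m y - (y j - x₀ j) ^ 2 * m y ^ 3) := fun j =>
    ((hφ.continuous.pow 2).mul (hmc.sub ((((PiLp.continuous_apply 2 _ j).sub
      continuous_const).pow 2).mul (hmc.pow 3)))).integrable_of_hasCompactSupport
      (hsupp fun x hx => by simp [hx])
  have hstep1 : ∫ y, φ y ^ 2 * m y ≤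
      (∫ y : EuclideanSpace ℝ (Fin 2), φ y ^ 2 * (m y - (y 0 - x₀ 0) ^ 2 * m y ^ 3)) +
        ∫ y : EuclideanSpace ℝ (Fin 2), φ y ^ 2 * (m y - (y 1 - x₀ 1) ^ 2 * m y ^ 3) := by
    rw [← integral_add (idiv 0) (idiv 1)]
    refine integral_mono iL ((idiv 0).add (idiv 1)) fun y => ?_
    have hkey : m y ≤ 2 * m y - ‖y - x₀‖ ^ 2 * m y ^ 3 := inv_regNorm_le_div_regField x₀ hε y
    have hn : ‖y - x₀‖ ^ 2 = (y 0 - x₀ 0) ^ 2 + (y 1 - x₀ 1) ^ 2 := by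
      rw [EuclideanSpace.norm_sq_eq]; simp [Fin.sum_univ_two]
    rw [hn] at hkey
    dsimp only
    have h2 := sq_nonneg (φ y)
    nlinarith [hkey, h2]
  -- Step 2: integrate by parts in each coordinate
  rw [integral_sq_mul_fderiv_regField hφ hφc x₀ hε 0, integral_sq_mul_fderiv_regField hφ hφc x₀ hε 1]
    at hstep1
  -- Step 3: the right-hand side is `−2 ∫ φ Dφ(y)[y − x₀] m ≤ 2 ∫ |φ| ‖Dφ‖`
  have iR : ∀ j : Fin 2, Integrable fun y : EuclideanSpace ℝ (Fin 2) =>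
      2 * φ y * fderiv ℝ φ y (EuclideanSpace.single j 1) * ((y j - x₀ j) * m y) := fun j =>
    ((((continuous_const.mul hφ.continuous).mul (hφ1c j)).mul (((PiLp.continuous_apply 2 _ j).sub
      continuous_const).mul hmc))).integrable_of_hasCompactSupport (hsupp fun x hx => by simp [hx])
  have iP : Integrable fun y => |φ y| * ‖fderiv ℝ φ y‖ :=
    (hφ.continuous.abs.mul hDc).integrable_of_hasCompactSupport (hsupp fun x hx => by simp [hx])
  have hstep3 : (-∫ y : EuclideanSpace ℝ (Fin 2), 2 * φ y * fderiv ℝ φ y (EuclideanSpace.single 0 1) *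
        ((y 0 - x₀ 0) * m y)) +
      -∫ y : EuclideanSpace ℝ (Fin 2), 2 * φ y * fderiv ℝ φ y (EuclideanSpace.single 1 1) *
        ((y 1 - x₀ 1) * m y) ≤ 2 * ∫ y, |φ y| * ‖fderiv ℝ φ y‖ := by
    rw [← neg_add, ← integral_add (iR 0) (iR 1), ← integral_neg, ← integral_const_mul]
    refine integral_mono ((iR 0).add (iR 1)).neg (iP.const_mul 2) fun y => ?_
    dsimp only [Pi.add_apply, Pi.neg_apply]
    -- `∑ᵢ ∂ᵢφ (yᵢ − x₀ᵢ) = Dφ(y)[y − x₀]` and `|Dφ(y)[y − x₀]| m ≤ ‖Dφ(y)‖`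
    have hDx : fderiv ℝ φ y (EuclideanSpace.single 0 1) * (y 0 - x₀ 0) +
        fderiv ℝ φ y (EuclideanSpace.single 1 1) * (y 1 - x₀ 1) = fderiv ℝ φ y (y - x₀) := by
      have e : y - x₀ = (y 0 - x₀ 0) • EuclideanSpace.single 0 (1 : ℝ) +
          (y 1 - x₀ 1) • EuclideanSpace.single 1 (1 : ℝ) := by
        ext j; fin_cases j <;> simp
      have h := congrArg (fderiv ℝ φ y) e
      rw [map_add, map_smul, map_smul, smul_eq_mul, smul_eq_mul] at h
      rw [h]; ring
    have hb : |fderiv ℝ φ y (y - x₀)| * m y ≤ ‖fderiv ℝ φ y‖ := by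
      calc |fderiv ℝ φ y (y - x₀)| * m y ≤ ‖fderiv ℝ φ y‖ * ‖y - x₀‖ * m y := by
            rw [← Real.norm_eq_abs]
            exact mul_le_mul_of_nonneg_right ((fderiv ℝ φ y).le_opNorm _) (hmpos y).le
        _ = ‖fderiv ℝ φ y‖ * (‖y - x₀‖ * m y) := by ring
        _ ≤ ‖fderiv ℝ φ y‖ * 1 :=
            mul_le_mul_of_nonneg_left (norm_sub_mul_inv_regNorm_le_one x₀ hε y) (norm_nonneg _)
        _ = ‖fderiv ℝ φ y‖ := mul_one _
    have hrew : -(2 * φ y * fderiv ℝ φ y (EuclideanSpace.single 0 1) * ((y 0 - x₀ 0) * m y) +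
        2 * φ y * fderiv ℝ φ y (EuclideanSpace.single 1 1) * ((y 1 - x₀ 1) * m y)) =
        -2 * (φ y * (fderiv ℝ φ y (y - x₀) * m y)) := by rw [← hDx]; ring
    rw [hrew]
    have hprod : |φ y * (fderiv ℝ φ y (y - x₀) * m y)| ≤ |φ y| * ‖fderiv ℝ φ y‖ := by
      rw [abs_mul, abs_mul, abs_of_pos (hmpos y)]
      exact mul_le_mul_of_nonneg_left hb (abs_nonneg _)
    have := neg_abs_le (φ y * (fderiv ℝ φ y (y - x₀) * m y))
    linarith
  -- Step 4: Cauchy–Schwarz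
  have hCS : ∫ y, |φ y| * ‖fderiv ℝ φ y‖ ≤ Real.sqrt (∫ y, φ y ^ 2) * Real.sqrt (∫ y, ‖fderiv ℝ φ y‖ ^ 2) := by
    have hpq : (2 : ℝ).HolderConjugate 2 := by
      rw [Real.holderConjugate_iff]; norm_num
    have h := integral_mul_le_Lp_mul_Lq_of_nonneg hpq (Eventually.of_forall fun y => abs_nonneg (φ y))
      (Eventually.of_forall fun y => norm_nonneg (fderiv ℝ φ y))
      (by simpa using (hφ.continuous.abs.memLp_of_hasCompactSupport (μ := volume) (p := 2)
        (hsupp fun x hx => by simp [hx])))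
      (by simpa using (hDc.memLp_of_hasCompactSupport (μ := volume) (p := 2)
        ((hφc.fderiv (𝕜 := ℝ)).norm)))
    have e1 : (∫ y, |φ y| ^ (2 : ℝ)) = ∫ y, φ y ^ 2 :=
      integral_congr_ae (Eventually.of_forall fun y => by dsimp only; rw [Real.rpow_two, sq_abs])
    have e2 : (∫ y, ‖fderiv ℝ φ y‖ ^ (2 : ℝ)) = ∫ y, ‖fderiv ℝ φ y‖ ^ 2 :=
      integral_congr_ae (Eventually.of_forall fun y => by dsimp only; rw [Real.rpow_two])
    rw [e1, e2, ← Real.sqrt_eq_rpow, ← Real.sqrt_eq_rpow] at h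
    exact h
  calc ∫ y, φ y ^ 2 * m y ≤ _ := hstep1
    _ ≤ 2 * ∫ y, |φ y| * ‖fderiv ℝ φ y‖ := hstep3
    _ ≤ 2 * (Real.sqrt (∫ y, φ y ^ 2) * Real.sqrt (∫ y, ‖fderiv ℝ φ y‖ ^ 2)) :=
        mul_le_mul_of_nonneg_left hCS (by norm_num)
    _ = _ := by ring

end Regularised

/-! ### The limit `ε → 0` -/

section Limit

variable {φ : EuclideanSpace ℝ (Fin 2) → ℝ} (hφ : ContDiff ℝ 1 φ) (hφc : HasCompactSupport φ)
  (x₀ : EuclideanSpace ℝ (Fin 2))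
include hφ hφc

/-- **The planar Hardy-type inequality.** For `φ ∈ C¹_c(ℝ²)` and every centre `x₀ ∈ ℝ²`, the
function `φ(y)²/|y − x₀|` is integrable and
`∫ φ(y)²/|y − x₀| dy ≤ 2 ‖φ‖_{L²} ‖Dφ‖_{L²} = 2 (∫ φ²)^{1/2} (∫ ‖Dφ‖²)^{1/2}`
(from the regularised inequality `integral_sq_mul_inv_regNorm_le` by monotone convergence as
`ε = 1/(k+1) → 0`; the single point `y = x₀` is Lebesgue-null). [folklore] -/
theorem integral_sq_div_norm_sub_le :
    Integrable (fun y : EuclideanSpace ℝ (Fin 2) => φ y ^ 2 / ‖y - x₀‖) ∧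
      ∫ y, φ y ^ 2 / ‖y - x₀‖ ≤
        2 * Real.sqrt (∫ y, φ y ^ 2) * Real.sqrt (∫ y, ‖fderiv ℝ φ y‖ ^ 2) := by
  set B : ℝ := 2 * Real.sqrt (∫ y, φ y ^ 2) * Real.sqrt (∫ y, ‖fderiv ℝ φ y‖ ^ 2) with hB
  have hB0 : 0 ≤ B := by positivity
  have hεk : ∀ k : ℕ, (0 : ℝ) < ((k : ℝ) + 1)⁻¹ := fun k => by positivity
  -- the approximants `φ² m_{1/(k+1)}` and the limit `φ²/|y − x₀|`
  set f : ℕ → EuclideanSpace ℝ (Fin 2) → ℝ≥0∞ := fun k y =>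
    ENNReal.ofReal (φ y ^ 2 * (Real.sqrt (‖y - x₀‖ ^ 2 + ((k : ℝ) + 1)⁻¹ ^ 2))⁻¹) with hf
  set F : EuclideanSpace ℝ (Fin 2) → ℝ≥0∞ := fun y => ENNReal.ofReal (φ y ^ 2 / ‖y - x₀‖) with hF
  have hfm : ∀ k, AEMeasurable (f k) volume := fun k =>
    ((hφ.continuous.pow 2).mul (continuous_inv_regNorm x₀ (hεk k))).measurable.ennreal_ofReal
      |>.aemeasurable
  have hmono : ∀ᵐ y ∂(volume : Measure (EuclideanSpace ℝ (Fin 2))), Monotone fun k => f k y := by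
    refine Eventually.of_forall fun y => fun k l hkl => ?_
    simp only [hf]
    refine ENNReal.ofReal_le_ofReal (mul_le_mul_of_nonneg_left ?_ (sq_nonneg _))
    have hk := regNorm_pos x₀ (hεk l) y
    rw [inv_le_inv₀ (regNorm_pos x₀ (hεk k) y) hk]
    refine Real.sqrt_le_sqrt (by
      have h1 : ((l : ℝ) + 1)⁻¹ ≤ ((k : ℝ) + 1)⁻¹ := by
        apply inv_anti₀ (by positivity)
        exact_mod_cast Nat.succ_le_succ hkl
      nlinarith [hεk l, hεk k])
  have hnull : ∀ᵐ y ∂(volume : Measure (EuclideanSpace ℝ (Fin 2))), y ≠ x₀ :=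
    compl_mem_ae_iff.2 (measure_singleton x₀)
  have hlim : ∀ᵐ y ∂(volume : Measure (EuclideanSpace ℝ (Fin 2))),
      Tendsto (fun k => f k y) atTop (𝓝 (F y)) := by
    filter_upwards [hnull] with y hy
    have hr : 0 < ‖y - x₀‖ := norm_pos_iff.2 (sub_ne_zero.2 hy)
    have h1 : Tendsto (fun k : ℕ => ((k : ℝ) + 1)⁻¹) atTop (𝓝 0) := by
      simpa [one_div] using tendsto_one_div_add_atTop_nhds_zero_nat (𝕜 := ℝ)
    have h2 : Tendsto (fun k : ℕ => Real.sqrt (‖y - x₀‖ ^ 2 + ((k : ℝ) + 1)⁻¹ ^ 2)) atTop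
        (𝓝 ‖y - x₀‖) := by
      have := ((h1.pow 2).const_add (‖y - x₀‖ ^ 2)).sqrt
      rwa [zero_pow two_ne_zero, add_zero, Real.sqrt_sq hr.le] at this
    have h3 := ENNReal.tendsto_ofReal ((h2.inv₀ hr.ne').const_mul (φ y ^ 2))
    simp only [hF, hf, div_eq_mul_inv]
    exact h3
  -- the uniform bound on the approximants
  have hbound : ∀ k, ∫⁻ y, f k y ≤ ENNReal.ofReal B := by
    intro k
    have hint : Integrable fun y : EuclideanSpace ℝ (Fin 2) =>
        φ y ^ 2 * (Real.sqrt (‖y - x₀‖ ^ 2 + ((k : ℝ) + 1)⁻¹ ^ 2))⁻¹ :=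
      ((hφ.continuous.pow 2).mul (continuous_inv_regNorm x₀ (hεk k))).integrable_of_hasCompactSupport
        (hφc.mono (by
          intro x hx
          simp only [Function.mem_support, ne_eq] at hx ⊢
          contrapose! hx
          simp [hx]))
    simp only [hf]
    rw [← ofReal_integral_eq_lintegral_ofReal hint (Eventually.of_forall fun y =>
      mul_nonneg (sq_nonneg _) (inv_nonneg.2 (regNorm_pos x₀ (hεk k) y).le))]
    exact ENNReal.ofReal_le_ofReal (integral_sq_mul_inv_regNorm_le hφ hφc x₀ (hεk k))
  have hkey : ∫⁻ y, F y ≤ ENNReal.ofReal B :=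
    le_of_tendsto' (lintegral_tendsto_of_tendsto_of_monotone hfm hmono hlim) hbound
  -- conclusion
  have hfun : (fun y : EuclideanSpace ℝ (Fin 2) => φ y ^ 2 / ‖y - x₀‖) =
      fun y => φ y ^ 2 * ‖y - x₀‖⁻¹ := by
    funext y; rw [div_eq_mul_inv]
  have hFm : AEStronglyMeasurable (fun y : EuclideanSpace ℝ (Fin 2) => φ y ^ 2 / ‖y - x₀‖) volume := by
    rw [hfun]
    exact ((hφ.continuous.pow 2).measurable.mul
      ((continuous_norm.comp (continuous_id.sub continuous_const)).measurable.inv)).aestronglyMeasurable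
  have hnn : 0 ≤ᵐ[volume] fun y : EuclideanSpace ℝ (Fin 2) => φ y ^ 2 / ‖y - x₀‖ :=
    Eventually.of_forall fun y => div_nonneg (sq_nonneg _) (norm_nonneg _)
  have hint : Integrable (fun y : EuclideanSpace ℝ (Fin 2) => φ y ^ 2 / ‖y - x₀‖) := by
    refine ⟨hFm, ?_⟩
    rw [hasFiniteIntegral_iff_enorm]
    calc ∫⁻ y, ‖φ y ^ 2 / ‖y - x₀‖‖ₑ = ∫⁻ y, F y :=
          lintegral_congr fun y => Real.enorm_eq_ofReal (div_nonneg (sq_nonneg _) (norm_nonneg _))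
      _ ≤ ENNReal.ofReal B := hkey
      _ < ⊤ := ENNReal.ofReal_lt_top
  refine ⟨hint, ?_⟩
  rw [integral_eq_lintegral_of_nonneg_ae hnn hFm]
  exact ENNReal.toReal_le_of_le_ofReal hB0 hkey

end Limit

end Literature.Analysis.FluidPDE
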